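import Mathlib
import Literature.Analysis.Complex.CauchyPompeiu
import Literature.Analysis.Complex.SimilarityLiouville
import Literature.Geometry.Symplectic.JHolomorphicMap
import Summits.SmoothPoincare4.SmoothPoincare4.Theorems.SullivanDualTameOrBrodyR4PencilDefs
import Summits.SmoothPoincare4.SmoothPoincare4.Theorems.SullivanDualTameOrBrodyR4CoreAChart

/-!
# Estimates for the vorticity density of a close member (stub `helper_memberToZeroAux`, line Sketch)

Crux `stmt-SmoothPoincare4-7826` (`TameOrBrodyR4`), line `Sketch`, CORE-A. For chart data `𝒞` at a
pencil member `u₀` and a map `u` which is `θ`-close to `u₀` (uniformly on `ℂ`, and in `C¹` and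
`C^{1,r}` on the closed disc of radius `ρ₁ + 3`), the vorticity density in normal form
`g = ∂̄ (Ψ⁻¹ (u - u₀))` — once known to vanish for `‖x‖ ≥ ρ₁ + 1` — satisfies
`‖g‖_∞ ≤ K θ` and `‖g x - g x'‖ ≤ K θ ‖x - x'‖ ^ r` with `K` depending only on the chart data
(`helper_memberToZeroAux`). This is the quantitative half of `helper_memberToZero` (a member close
to `u₀` is a SMALL zero of the vorticity map); the file also collects the small lemmas used there
(namespace `MemberToZero`): a product estimate, bounds for smooth maps on a disc, far-constancy of
`J`, the tails of `u - u₀`, the limit of the normal form, a vector-valued Liouville theorem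
(from `Literature.Analysis.Complex.eq_zero_of_dbar_le_of_tendsto_zero`) and the algebra of the
zero equation.

Proof of the estimate: `D(Ψ⁻¹ d) v = Ψ⁻¹ (Dd v) + (DΨ⁻¹ v) d` (`d = u - u₀`); sup and Lipschitz
bounds of `Ψ⁻¹`, `DΨ⁻¹` on the disc (compactness, mean value inequality) and the closeness
hypotheses bound each product and its increments (`‖B φ - B' φ'‖ ≤ ‖B - B'‖ ‖φ‖ + ‖B'‖ ‖φ - φ'‖`);
off the disc `g = 0`, and a point where `g ≠ 0` is at distance `≥ 1` from the complement of the
disc.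
-/

-- the registered namespace `Summit.SmoothPoincare4.SmoothPoincare4.…` repeats a component
set_option linter.dupNamespace false

noncomputable section

open scoped ContDiff Topology NNReal
open Filter Set Metric Literature.Analysis.Complex Literature.Geometry.Symplectic

namespace Summit.SmoothPoincare4.SmoothPoincare4.Cruxes.TameOrBrodyR4.Sketch

/-- Local notation for the model space `ℝ⁴ = EuclideanSpace ℝ (Fin 4)`. -/
local notation "E4" => EuclideanSpace ℝ (Fin 4)

namespace MemberToZero

/-! ### Small lemmas -/

/-- Product estimate: `‖B φ - B' φ'‖ ≤ ‖B - B'‖ ‖φ‖ + ‖B'‖ ‖φ - φ'‖`, with Lipschitz/sup bounds for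
the operators and sup/Hölder bounds for the vectors plugged in. -/
theorem norm_apply_sub_apply_le {G H : Type*} [NormedAddCommGroup G] [NormedSpace ℝ G]
    [NormedAddCommGroup H] [NormedSpace ℝ H] (B B' : G →L[ℝ] H) (φ φ' : G)
    {N d a a' s L : ℝ} (hBB' : ‖B - B'‖ ≤ N * d) (hB' : ‖B'‖ ≤ N) (hφ : ‖φ‖ ≤ a)
    (hφφ' : ‖φ - φ'‖ ≤ a' * s) (hd : d ≤ L * s) (hN : 0 ≤ N) (ha : 0 ≤ a) :
    ‖B φ - B' φ'‖ ≤ (N * L * a + N * a') * s := by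
  have e : B φ - B' φ' = (B - B') φ + B' (φ - φ') := by
    rw [map_sub, show (B - B') φ = B φ - B' φ from rfl]; abel
  have h1 : ‖(B - B') φ‖ ≤ N * d * a :=
    ((B - B').le_opNorm φ).trans (mul_le_mul hBB' hφ (norm_nonneg _) ((norm_nonneg _).trans hBB'))
  have h2 : ‖B' (φ - φ')‖ ≤ N * (a' * s) :=
    (B'.le_opNorm _).trans (mul_le_mul hB' hφφ' (norm_nonneg _) hN)
  have h3 : N * d * a ≤ N * (L * s) * a :=
    mul_le_mul_of_nonneg_right (mul_le_mul_of_nonneg_left hd hN) ha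
  rw [e]
  calc ‖(B - B') φ + B' (φ - φ')‖ ≤ N * d * a + N * (a' * s) := norm_add_le_of_le h1 h2
    _ ≤ N * (L * s) * a + N * (a' * s) := by linarith
    _ = (N * L * a + N * a') * s := by ring

/-- A `C^∞` map on `ℂ` is bounded and Lipschitz on every closed disc, with one nonnegative constant
(continuity on the compact disc; mean value inequality on the convex disc). -/
theorem exists_bound_lip {X : Type*} [NormedAddCommGroup X] [NormedSpace ℝ X] {B : ℂ → X}
    (hB : ContDiff ℝ ∞ B) (ρ : ℝ) :
    ∃ N : ℝ, 0 ≤ N ∧ (∀ x ∈ closedBall (0 : ℂ) ρ, ‖B x‖ ≤ N) ∧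
      ∀ x ∈ closedBall (0 : ℂ) ρ, ∀ x' ∈ closedBall (0 : ℂ) ρ, ‖B x - B x'‖ ≤ N * ‖x - x'‖ := by
  obtain ⟨C, hC⟩ := (isCompact_closedBall (0 : ℂ) ρ).exists_bound_of_continuousOn
    (hB.continuous_fderiv (by simp)).continuousOn
  obtain ⟨M, hM⟩ := (isCompact_closedBall (0 : ℂ) ρ).exists_bound_of_continuousOn
    hB.continuous.continuousOn
  refine ⟨max (max C M) 0, le_max_right _ _, fun x hx => (hM x hx).trans
    ((le_max_right _ _).trans (le_max_left _ _)), fun x hx x' hx' => ?_⟩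
  have h := (convex_closedBall (0 : ℂ) ρ).norm_image_sub_le_of_norm_fderiv_le
    (fun y _ => hB.differentiable (by simp) y) hC hx' hx
  exact h.trans (mul_le_mul_of_nonneg_right ((le_max_left _ _).trans (le_max_left _ _))
    (norm_nonneg _))

/-- On a disc of radius `ρ`, `‖x - x'‖ ≤ (2ρ + 1) ‖x - x'‖ ^ r` for `0 ≤ r ≤ 1`. -/
theorem norm_sub_le_mul_rpow {ρ r : ℝ} (hρ : 0 ≤ ρ) (hr0 : 0 ≤ r) (hr1 : r ≤ 1) {x x' : ℂ}
    (hx : x ∈ closedBall (0 : ℂ) ρ) (hx' : x' ∈ closedBall (0 : ℂ) ρ) :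
    ‖x - x'‖ ≤ (2 * ρ + 1) * ‖x - x'‖ ^ r := by
  rw [mem_closedBall_zero_iff] at hx hx'
  have hd : ‖x - x'‖ ≤ 2 * ρ := (norm_sub_le _ _).trans (by linarith)
  rcases le_or_gt ‖x - x'‖ 1 with h | h
  · calc ‖x - x'‖ ≤ ‖x - x'‖ ^ r := Real.self_le_rpow_of_le_one (norm_nonneg _) h hr1
      _ ≤ (2 * ρ + 1) * ‖x - x'‖ ^ r := le_mul_of_one_le_left (by positivity) (by linarith)
  · have h1 : (1 : ℝ) ≤ ‖x - x'‖ ^ r := Real.one_le_rpow h.le hr0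
    nlinarith

/-- Far out `J` is constant: `J x = J y` when `R ≤ ‖x‖` and `R ≤ ‖y‖` (both are determined by their
action on the two coordinates, where they are multiplication by `i`). -/
theorem J_eq_of_far {J : E4 → E4 →L[ℝ] E4} {R : ℝ} {P Q : E4 →L[ℝ] ℂ} {eP eQ : ℂ →L[ℝ] E4}
    (hPQ : IsCoordFrame P Q eP eQ)
    (hJP : ∀ x : E4, R ≤ ‖x‖ → ∀ v, P (J x v) = Complex.I * P v)
    (hJQ : ∀ x : E4, R ≤ ‖x‖ → ∀ v, Q (J x v) = Complex.I * Q v) {x y : E4} (hx : R ≤ ‖x‖)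
    (hy : R ≤ ‖y‖) : J x = J y :=
  ContinuousLinearMap.ext fun v => PencilDefs.eq_of_apply_eq hPQ
    (by rw [hJP x hx v, hJP y hy v]) (by rw [hJQ x hx v, hJQ y hy v])

/-- **Tails.** For two maps with the member asymptotics (`Q ∘ u → b₀ + β`, `Q ∘ u₀ → b₀`, both
normalised by `P (u ξ) - ξ → 0`), `u - u₀ → eQ β` at infinity (split by the frame identity
`eP ∘ P + eQ ∘ Q = id`). -/
theorem tendsto_sub_of_tails {P Q : E4 →L[ℝ] ℂ} {eP eQ : ℂ →L[ℝ] E4} (hPQ : IsCoordFrame P Q eP eQ)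
    {u u₀ : ℂ → E4} {b₀ β : ℂ}
    (hQ : Tendsto (fun ξ => Q (u ξ)) (cocompact ℂ) (𝓝 (b₀ + β)))
    (hP : Tendsto (fun ξ => P (u ξ) - ξ) (cocompact ℂ) (𝓝 0))
    (hQ₀ : Tendsto (fun ξ => Q (u₀ ξ)) (cocompact ℂ) (𝓝 b₀))
    (hP₀ : Tendsto (fun ξ => P (u₀ ξ) - ξ) (cocompact ℂ) (𝓝 0)) :
    Tendsto (fun ξ => u ξ - u₀ ξ) (cocompact ℂ) (𝓝 (eQ β)) := by
  have hframe := hPQ.2.2.2.2.2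
  have e : ∀ ξ, eP ((P (u ξ) - ξ) - (P (u₀ ξ) - ξ)) + eQ (Q (u ξ) - Q (u₀ ξ)) = u ξ - u₀ ξ := by
    intro ξ
    rw [sub_sub_sub_cancel_right, ← P.map_sub, ← Q.map_sub, hframe]
  have h1 := ((eP.continuous.tendsto _).comp (hP.sub hP₀)).add
    ((eQ.continuous.tendsto _).comp (hQ.sub hQ₀))
  simp only [sub_self, map_zero, zero_add, add_sub_cancel_left] at h1
  exact h1.congr fun ξ => by simp only [Function.comp_apply, e]

/-- **Vector Liouville.** A smooth `k : ℂ → ℂ × ℂ` with `∂̄ k = 0` tending to `0` at infinity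
vanishes (the Liouville theorem of the similarity principle, on each component). -/
theorem eq_zero_of_dbar_eq_zero {k : ℂ → ℂ × ℂ} (hks : ContDiff ℝ ∞ k)
    (hdbar : ∀ z, dbarAlong (1 : ℂ) k z = 0) (hlim : Tendsto k (cocompact ℂ) (𝓝 0)) : k = 0 := by
  have hkd : Differentiable ℝ k := hks.differentiable (by simp)
  have h1 : (fun z => (k z).1) = 0 := by
    refine eq_zero_of_dbar_le_of_tendsto_zero _ (fun _ => 0) 0 0 hks.fst contDiff_const
      (fun z => ?_) (fun z => by simp) (fun z _ => rfl) ?_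
    · rw [← fst_dbarAlong (hkd z), hdbar z]; rfl
    · simpa using hlim.fst_nhds
  have h2 : (fun z => (k z).2) = 0 := by
    refine eq_zero_of_dbar_le_of_tendsto_zero _ (fun _ => 0) 0 0 hks.snd contDiff_const
      (fun z => ?_) (fun z => by simp) (fun z _ => rfl) ?_
    · rw [← snd_dbarAlong (hkd z), hdbar z]; rfl
    · simpa using hlim.snd_nhds
  funext z
  exact Prod.ext (congrFun h1 z) (congrFun h2 z)

/-- `∂̄` of a `C^∞` map is `C^∞`. -/
theorem contDiff_dbar {F : Type*} [NormedAddCommGroup F] [NormedSpace ℂ F] {w : ℂ → F}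
    (hw : ContDiff ℝ ∞ w) : ContDiff ℝ ∞ (dbarAlong (1 : ℂ) w) := by
  have hD : ContDiff ℝ ∞ (fderiv ℝ w) := (contDiff_infty_iff_fderiv.mp hw).2
  rw [show dbarAlong (1 : ℂ) w = fun x => (2 : ℂ)⁻¹ • (fderiv ℝ w x 1 +
    Complex.I • fderiv ℝ w x Complex.I) from funext (dbarAlong_one w)]
  exact ((hD.clm_apply contDiff_const).add
    ((hD.clm_apply contDiff_const).const_smul _)).const_smul _

/-- The algebra of the zero equation: from `2 g + A = 0`, where `c = 1` or `g = 0`, to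
`g + c • ½ • A = 0`. -/
theorem zero_equation_of {g A : ℂ × ℂ} {c : ℝ} (h : (2 : ℂ) • g + A = 0) (hc : c = 1 ∨ g = 0) :
    g + c • (1 / 2 : ℝ) • A = 0 := by
  obtain rfl : A = -((2 : ℝ) • g) := by
    rw [← Complex.coe_smul, Complex.ofReal_ofNat]; exact eq_neg_of_add_eq_zero_right h
  rcases hc with rfl | hg
  · rw [one_smul, smul_neg, smul_smul, show (1 / 2 : ℝ) * 2 = 1 by norm_num, one_smul,
      add_neg_cancel]
  · rw [hg]; simp

/-! ### The estimate for `∂̄ (Φ d)` -/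

/-- Product rule for the normal form `y ↦ Φ y (d y)`. -/
theorem fderiv_conj_apply {Φ : ℂ → E4 →L[ℝ] (ℂ × ℂ)} {d : ℂ → E4} (hΦ : Differentiable ℝ Φ)
    (hd : Differentiable ℝ d) (x v : ℂ) :
    fderiv ℝ (fun y => Φ y (d y)) x v = Φ x (fderiv ℝ d x v) + (fderiv ℝ Φ x v) (d x) := by
  rw [((hΦ x).hasFDerivAt.clm_apply (hd x).hasFDerivAt).fderiv]; rfl

/-- Sup bound for `D(Φ d)` on the disc. -/
theorem norm_fderiv_conj_le {Φ : ℂ → E4 →L[ℝ] (ℂ × ℂ)} {d : ℂ → E4} (hΦ : Differentiable ℝ Φ)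
    (hd : Differentiable ℝ d) {ρ N θ : ℝ} (hN : 0 ≤ N) (hθ : 0 ≤ θ)
    (hNa : ∀ x ∈ closedBall (0 : ℂ) ρ, ‖Φ x‖ ≤ N)
    (hNb : ∀ x ∈ closedBall (0 : ℂ) ρ, ‖fderiv ℝ Φ x‖ ≤ N) (hC0 : ∀ x, ‖d x‖ ≤ θ)
    (hC1 : ∀ x ∈ closedBall (0 : ℂ) ρ, ‖fderiv ℝ d x‖ ≤ θ) {x : ℂ} (hx : x ∈ closedBall (0 : ℂ) ρ)
    {v : ℂ} (hv : ‖v‖ ≤ 1) : ‖fderiv ℝ (fun y => Φ y (d y)) x v‖ ≤ 2 * N * θ := by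
  rw [fderiv_conj_apply hΦ hd]
  have h1 : ‖Φ x (fderiv ℝ d x v)‖ ≤ N * θ :=
    ((Φ x).le_opNorm _).trans (mul_le_mul (hNa x hx) (((fderiv ℝ d x).le_opNorm v).trans
      ((mul_le_mul (hC1 x hx) hv (norm_nonneg _) hθ).trans_eq (mul_one θ))) (norm_nonneg _) hN)
  have h2 : ‖(fderiv ℝ Φ x v) (d x)‖ ≤ N * θ :=
    ((fderiv ℝ Φ x v).le_opNorm _).trans (mul_le_mul (((fderiv ℝ Φ x).le_opNorm v).trans
      ((mul_le_mul (hNb x hx) hv (norm_nonneg _) hN).trans_eq (mul_one N))) (hC0 x)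
      (norm_nonneg _) hN)
  exact (norm_add_le_of_le h1 h2).trans_eq (by ring)

/-- Hölder bound for `D(Φ d)` on the disc. -/
theorem norm_fderiv_conj_sub_le {Φ : ℂ → E4 →L[ℝ] (ℂ × ℂ)} {d : ℂ → E4}
    (hΦ : Differentiable ℝ Φ) (hd : Differentiable ℝ d) {ρ N θ L r : ℝ} (hN : 0 ≤ N) (hθ : 0 ≤ θ)
    (hNa : ∀ x ∈ closedBall (0 : ℂ) ρ, ‖Φ x‖ ≤ N)
    (hNa' : ∀ x ∈ closedBall (0 : ℂ) ρ, ∀ x' ∈ closedBall (0 : ℂ) ρ, ‖Φ x - Φ x'‖ ≤ N * ‖x - x'‖)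
    (hNb : ∀ x ∈ closedBall (0 : ℂ) ρ, ‖fderiv ℝ Φ x‖ ≤ N)
    (hNb' : ∀ x ∈ closedBall (0 : ℂ) ρ, ∀ x' ∈ closedBall (0 : ℂ) ρ,
      ‖fderiv ℝ Φ x - fderiv ℝ Φ x'‖ ≤ N * ‖x - x'‖)
    (hC0 : ∀ x, ‖d x‖ ≤ θ) (hC1 : ∀ x ∈ closedBall (0 : ℂ) ρ, ‖fderiv ℝ d x‖ ≤ θ)
    (hCr : ∀ x ∈ closedBall (0 : ℂ) ρ, ∀ x' ∈ closedBall (0 : ℂ) ρ,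
      ‖fderiv ℝ d x - fderiv ℝ d x'‖ ≤ θ * ‖x - x'‖ ^ r)
    (hL : ∀ x ∈ closedBall (0 : ℂ) ρ, ∀ x' ∈ closedBall (0 : ℂ) ρ, ‖x - x'‖ ≤ L * ‖x - x'‖ ^ r)
    {x x' : ℂ} (hx : x ∈ closedBall (0 : ℂ) ρ) (hx' : x' ∈ closedBall (0 : ℂ) ρ) {v : ℂ}
    (hv : ‖v‖ ≤ 1) :
    ‖fderiv ℝ (fun y => Φ y (d y)) x v - fderiv ℝ (fun y => Φ y (d y)) x' v‖ ≤
      (3 * N * L + N) * θ * ‖x - x'‖ ^ r := by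
  have ht : 0 ≤ ‖x - x'‖ ^ r := by positivity
  have hdL : ‖d x - d x'‖ ≤ θ * L * ‖x - x'‖ ^ r :=
    calc ‖d x - d x'‖ ≤ θ * ‖x - x'‖ :=
          (convex_closedBall (0 : ℂ) ρ).norm_image_sub_le_of_norm_fderiv_le (fun y _ => hd y) hC1
            hx' hx
      _ ≤ θ * (L * ‖x - x'‖ ^ r) := mul_le_mul_of_nonneg_left (hL x hx x' hx') hθ
      _ = θ * L * ‖x - x'‖ ^ r := by ring
  rw [fderiv_conj_apply hΦ hd, fderiv_conj_apply hΦ hd]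
  have h1 : ‖Φ x (fderiv ℝ d x v) - Φ x' (fderiv ℝ d x' v)‖ ≤
      (N * L * θ + N * θ) * ‖x - x'‖ ^ r := by
    refine norm_apply_sub_apply_le _ _ _ _ (hNa' x hx x' hx') (hNa x' hx') ?_ ?_ (hL x hx x' hx')
      hN hθ
    · exact ((fderiv ℝ d x).le_opNorm v).trans
        ((mul_le_mul (hC1 x hx) hv (norm_nonneg _) hθ).trans_eq (mul_one θ))
    · rw [show fderiv ℝ d x v - fderiv ℝ d x' v = (fderiv ℝ d x - fderiv ℝ d x') v from rfl]
      exact ((fderiv ℝ d x - fderiv ℝ d x').le_opNorm v).trans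
        ((mul_le_mul (hCr x hx x' hx') hv (norm_nonneg _) (mul_nonneg hθ ht)).trans_eq
          (mul_one _))
  have h2 : ‖(fderiv ℝ Φ x v) (d x) - (fderiv ℝ Φ x' v) (d x')‖ ≤
      (N * L * θ + N * (θ * L)) * ‖x - x'‖ ^ r := by
    refine norm_apply_sub_apply_le _ _ _ _ ?_ ?_ (hC0 x) hdL (hL x hx x' hx') hN hθ
    · rw [show fderiv ℝ Φ x v - fderiv ℝ Φ x' v = (fderiv ℝ Φ x - fderiv ℝ Φ x') v from rfl]
      exact ((fderiv ℝ Φ x - fderiv ℝ Φ x').le_opNorm v).trans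
        ((mul_le_mul (hNb' x hx x' hx') hv (norm_nonneg _)
          (mul_nonneg hN (norm_nonneg _))).trans_eq (mul_one _))
    · exact ((fderiv ℝ Φ x').le_opNorm v).trans
        ((mul_le_mul (hNb x' hx') hv (norm_nonneg _) hN).trans_eq (mul_one N))
  calc ‖Φ x (fderiv ℝ d x v) + (fderiv ℝ Φ x v) (d x) -
        (Φ x' (fderiv ℝ d x' v) + (fderiv ℝ Φ x' v) (d x'))‖ =
      ‖(Φ x (fderiv ℝ d x v) - Φ x' (fderiv ℝ d x' v)) +
        ((fderiv ℝ Φ x v) (d x) - (fderiv ℝ Φ x' v) (d x'))‖ := by congr 1; abel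
    _ ≤ (N * L * θ + N * θ) * ‖x - x'‖ ^ r + (N * L * θ + N * (θ * L)) * ‖x - x'‖ ^ r :=
      norm_add_le_of_le h1 h2
    _ = (3 * N * L + N) * θ * ‖x - x'‖ ^ r := by ring

/-- **Sup and Hölder bounds for `∂̄ (Φ d)`**, assuming it vanishes for `‖x‖ ≥ ρ - 2`. -/
theorem dbar_conj_bounds {Φ : ℂ → E4 →L[ℝ] (ℂ × ℂ)} {d : ℂ → E4}
    (hΦ : Differentiable ℝ Φ) (hd : Differentiable ℝ d) {ρ N θ L r : ℝ} (hN : 0 ≤ N) (hθ : 0 ≤ θ)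
    (hL0 : 0 ≤ L) (hr0 : 0 ≤ r) (hNa : ∀ x ∈ closedBall (0 : ℂ) ρ, ‖Φ x‖ ≤ N)
    (hNa' : ∀ x ∈ closedBall (0 : ℂ) ρ, ∀ x' ∈ closedBall (0 : ℂ) ρ, ‖Φ x - Φ x'‖ ≤ N * ‖x - x'‖)
    (hNb : ∀ x ∈ closedBall (0 : ℂ) ρ, ‖fderiv ℝ Φ x‖ ≤ N)
    (hNb' : ∀ x ∈ closedBall (0 : ℂ) ρ, ∀ x' ∈ closedBall (0 : ℂ) ρ,
      ‖fderiv ℝ Φ x - fderiv ℝ Φ x'‖ ≤ N * ‖x - x'‖)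
    (hC0 : ∀ x, ‖d x‖ ≤ θ) (hC1 : ∀ x ∈ closedBall (0 : ℂ) ρ, ‖fderiv ℝ d x‖ ≤ θ)
    (hCr : ∀ x ∈ closedBall (0 : ℂ) ρ, ∀ x' ∈ closedBall (0 : ℂ) ρ,
      ‖fderiv ℝ d x - fderiv ℝ d x'‖ ≤ θ * ‖x - x'‖ ^ r)
    (hL : ∀ x ∈ closedBall (0 : ℂ) ρ, ∀ x' ∈ closedBall (0 : ℂ) ρ, ‖x - x'‖ ≤ L * ‖x - x'‖ ^ r)
    (hvan : ∀ x, ρ - 2 ≤ ‖x‖ → dbarAlong (1 : ℂ) (fun y => Φ y (d y)) x = 0) :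
    (∀ x, ‖dbarAlong (1 : ℂ) (fun y => Φ y (d y)) x‖ ≤ 2 * N * θ) ∧
    (∀ x x', ‖dbarAlong (1 : ℂ) (fun y => Φ y (d y)) x - dbarAlong (1 : ℂ) (fun y => Φ y (d y)) x'‖
      ≤ (3 * N * L + 2 * N) * θ * ‖x - x'‖ ^ r) := by
  set w : ℂ → ℂ × ℂ := fun y => Φ y (d y) with hw
  have h11 : ‖(1 : ℂ)‖ ≤ 1 := by simp
  have hI1 : ‖(Complex.I : ℂ)‖ ≤ 1 := by simp
  have h2n : ‖(2 : ℂ)⁻¹‖ = 2⁻¹ := by simp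
  -- sup bound
  have hsup : ∀ x, ‖dbarAlong (1 : ℂ) w x‖ ≤ 2 * N * θ := by
    intro x
    by_cases hx : x ∈ closedBall (0 : ℂ) ρ
    · rw [dbarAlong_one, norm_smul, h2n]
      have hB : ‖Complex.I • fderiv ℝ w x Complex.I‖ ≤ 2 * N * θ := by
        rw [norm_smul, Complex.norm_I, one_mul]
        exact norm_fderiv_conj_le hΦ hd hN hθ hNa hNb hC0 hC1 hx hI1
      have := norm_add_le_of_le (norm_fderiv_conj_le hΦ hd hN hθ hNa hNb hC0 hC1 hx h11) hB
      linarith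
    · rw [mem_closedBall_zero_iff, not_le] at hx
      rw [hvan x (by linarith), norm_zero]; positivity
  refine ⟨hsup, ?_⟩
  -- Hölder bound on the disc
  have hholS : ∀ x ∈ closedBall (0 : ℂ) ρ, ∀ x' ∈ closedBall (0 : ℂ) ρ,
      ‖dbarAlong (1 : ℂ) w x - dbarAlong (1 : ℂ) w x'‖ ≤ (3 * N * L + N) * θ * ‖x - x'‖ ^ r := by
    intro x hx x' hx'
    have hterm := fun v : ℂ =>
      norm_fderiv_conj_sub_le hΦ hd hN hθ hNa hNa' hNb hNb' hC0 hC1 hCr hL hx hx' (v := v)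
    rw [dbarAlong_one, dbarAlong_one, ← smul_sub, norm_smul, h2n]
    have hB : ‖Complex.I • fderiv ℝ w x Complex.I - Complex.I • fderiv ℝ w x' Complex.I‖ ≤
        (3 * N * L + N) * θ * ‖x - x'‖ ^ r := by
      rw [← smul_sub, norm_smul, Complex.norm_I, one_mul]; exact hterm _ hI1
    calc 2⁻¹ * ‖fderiv ℝ w x 1 + Complex.I • fderiv ℝ w x Complex.I -
          (fderiv ℝ w x' 1 + Complex.I • fderiv ℝ w x' Complex.I)‖ =
        2⁻¹ * ‖(fderiv ℝ w x 1 - fderiv ℝ w x' 1) +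
          (Complex.I • fderiv ℝ w x Complex.I - Complex.I • fderiv ℝ w x' Complex.I)‖ := by
          congr 2; abel
      _ ≤ 2⁻¹ * ((3 * N * L + N) * θ * ‖x - x'‖ ^ r + (3 * N * L + N) * θ * ‖x - x'‖ ^ r) := by
          gcongr; exact norm_add_le_of_le (hterm 1 h11) hB
      _ = (3 * N * L + N) * θ * ‖x - x'‖ ^ r := by ring
  -- one point outside the disc
  have aux : ∀ x x', x' ∉ closedBall (0 : ℂ) ρ →
      ‖dbarAlong (1 : ℂ) w x - dbarAlong (1 : ℂ) w x'‖ ≤ 2 * N * θ * ‖x - x'‖ ^ r := by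
    intro x x' hx'
    rw [mem_closedBall_zero_iff, not_le] at hx'
    rw [hvan x' (by linarith), sub_zero]
    by_cases hx : ρ - 2 ≤ ‖x‖
    · rw [hvan x hx, norm_zero]; positivity
    · have hd1 : 1 ≤ ‖x - x'‖ := by
        have := norm_sub_norm_le x' x
        rw [norm_sub_rev] at this
        linarith [not_le.mp hx]
      exact (hsup x).trans (le_mul_of_one_le_right (by positivity) (Real.one_le_rpow hd1 hr0))
  intro x x'
  have ht : 0 ≤ ‖x - x'‖ ^ r := by positivity
  have hp1 : 0 ≤ N * θ * ‖x - x'‖ ^ r := mul_nonneg (mul_nonneg hN hθ) ht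
  have hp2 : 0 ≤ 3 * N * L * θ * ‖x - x'‖ ^ r :=
    mul_nonneg (mul_nonneg (mul_nonneg (mul_nonneg (by norm_num) hN) hL0) hθ) ht
  have e1 : (3 * N * L + 2 * N) * θ * ‖x - x'‖ ^ r =
      (3 * N * L + N) * θ * ‖x - x'‖ ^ r + N * θ * ‖x - x'‖ ^ r := by ring
  have e2 : (3 * N * L + 2 * N) * θ * ‖x - x'‖ ^ r =
      2 * N * θ * ‖x - x'‖ ^ r + 3 * N * L * θ * ‖x - x'‖ ^ r := by ring
  by_cases hx' : x' ∈ closedBall (0 : ℂ) ρ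
  · by_cases hx : x ∈ closedBall (0 : ℂ) ρ
    · rw [e1]; exact (hholS x hx x' hx').trans (le_add_of_nonneg_right hp1)
    · have h := aux x' x hx
      rw [norm_sub_rev, norm_sub_rev x'] at h
      rw [e2]; exact h.trans (le_add_of_nonneg_right hp2)
  · rw [e2]; exact (aux x x' hx').trans (le_add_of_nonneg_right hp2)

/-! ### The limit of the normal form -/

/-- **The normal form tends to `(0, β)`**: for a map `u` with the member asymptotics of value
`b₀ + β`, `Ψ⁻¹ (u - u₀) → (0, β)` at infinity (`u - u₀ → eQ β`, `Ψ⁻¹` is bounded, and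
`Ψ⁻¹ (eQ β) = (0, β)` where the frame is standard). -/
theorem tendsto_normalForm {J : E4 → E4 →L[ℝ] E4} {R : ℝ} {P Q : E4 →L[ℝ] ℂ} {eP eQ : ℂ →L[ℝ] E4}
    {b₀ : ℂ} {u₀ : ℂ → E4} (𝒞 : CoreA.ChartData J R P Q eP eQ b₀ u₀) (hPQ : IsCoordFrame P Q eP eQ)
    {u : ℂ → E4} {β : ℂ} (hQ : Tendsto (fun ξ => Q (u ξ)) (cocompact ℂ) (𝓝 (b₀ + β)))
    (hP : Tendsto (fun ξ => P (u ξ) - ξ) (cocompact ℂ) (𝓝 0))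
    (hQ₀ : Tendsto (fun ξ => Q (u₀ ξ)) (cocompact ℂ) (𝓝 b₀))
    (hP₀ : Tendsto (fun ξ => P (u₀ ξ) - ξ) (cocompact ℂ) (𝓝 0)) :
    Tendsto (fun y => 𝒞.Ψinv y (u y - u₀ y)) (cocompact ℂ) (𝓝 ((0 : ℂ), β)) := by
  have hv := tendsto_sub_of_tails hPQ hQ hP hQ₀ hP₀
  have h0 : Tendsto (fun ξ => 𝒞.CΨ * ‖u ξ - u₀ ξ - eQ β‖) (cocompact ℂ) (𝓝 0) := by
    simpa using (tendsto_iff_norm_sub_tendsto_zero.1 hv).const_mul 𝒞.CΨ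
  rw [tendsto_iff_norm_sub_tendsto_zero]
  refine squeeze_zero' (Eventually.of_forall fun _ => norm_nonneg _) ?_ h0
  filter_upwards [tendsto_norm_cocompact_atTop.eventually_ge_atTop 𝒞.ρ₁] with ξ hξ
  have hfix : 𝒞.Ψinv ξ (eQ β) = ((0 : ℂ), β) := by
    have h1 : 𝒞.Ψ ξ ((0 : ℂ), β) = eQ β := by rw [𝒞.hΨfar ξ hξ]; simp
    rw [← h1]
    simpa using congrArg (fun M : (ℂ × ℂ) →L[ℝ] (ℂ × ℂ) => M ((0 : ℂ), β)) (𝒞.hleft ξ)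
  calc ‖𝒞.Ψinv ξ (u ξ - u₀ ξ) - ((0 : ℂ), β)‖ = ‖𝒞.Ψinv ξ (u ξ - u₀ ξ - eQ β)‖ := by
        rw [map_sub (𝒞.Ψinv ξ) (u ξ - u₀ ξ) (eQ β), hfix]
    _ ≤ 𝒞.CΨ * ‖u ξ - u₀ ξ - eQ β‖ := (𝒞.Ψinv ξ).le_of_opNorm_le (𝒞.hΨinvbd ξ) _

end MemberToZero

/-- **Stub `helper_memberToZeroAux` (MZ, quantitative half).** For chart data `𝒞` at `u₀` there is
`K > 0` such that for every `θ ≥ 0` and every smooth `u` which is `θ`-close to `u₀` (uniformly on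
`ℂ`, in `C¹` and in `C^{1,r}` on the closed disc of radius `ρ₁ + 3`) and whose vorticity density
`g = ∂̄ (Ψ⁻¹ (u - u₀))` vanishes for `‖x‖ ≥ ρ₁ + 1`, one has `‖g x‖ ≤ K θ` and
`‖g x - g x'‖ ≤ K θ ‖x - x'‖ ^ r` for all `x, x'`. -/
theorem helper_memberToZeroAux (J : E4 → E4 →L[ℝ] E4) (R : ℝ) (P Q : E4 →L[ℝ] ℂ)
    (eP eQ : ℂ →L[ℝ] E4) {r : ℝ≥0} (hr1 : r ≤ 1) (b₀ : ℂ) (u₀ : ℂ → E4) (hu₀s : ContDiff ℝ ∞ u₀)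
    (𝒞 : CoreA.ChartData J R P Q eP eQ b₀ u₀) :
    ∃ K > (0 : ℝ), ∀ (θ : ℝ) (u : ℂ → E4), 0 ≤ θ → ContDiff ℝ ∞ u →
      (∀ ξ, ‖u ξ - u₀ ξ‖ ≤ θ) →
      (∀ ξ ∈ closedBall (0 : ℂ) (𝒞.ρ₁ + 3), ‖fderiv ℝ u ξ - fderiv ℝ u₀ ξ‖ ≤ θ) →
      (∀ ξ ∈ closedBall (0 : ℂ) (𝒞.ρ₁ + 3), ∀ ξ' ∈ closedBall (0 : ℂ) (𝒞.ρ₁ + 3),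
        ‖(fderiv ℝ u ξ - fderiv ℝ u₀ ξ) - (fderiv ℝ u ξ' - fderiv ℝ u₀ ξ')‖ ≤
          θ * ‖ξ - ξ'‖ ^ (r : ℝ)) →
      (∀ x, 𝒞.ρ₁ + 1 ≤ ‖x‖ → dbarAlong (1 : ℂ) (fun y => 𝒞.Ψinv y (u y - u₀ y)) x = 0) →
      (∀ x, ‖dbarAlong (1 : ℂ) (fun y => 𝒞.Ψinv y (u y - u₀ y)) x‖ ≤ K * θ) ∧
      (∀ x x', ‖dbarAlong (1 : ℂ) (fun y => 𝒞.Ψinv y (u y - u₀ y)) x -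
          dbarAlong (1 : ℂ) (fun y => 𝒞.Ψinv y (u y - u₀ y)) x'‖ ≤
        K * θ * ‖x - x'‖ ^ (r : ℝ)) := by
  have hρ₁ := 𝒞.hρ₁
  obtain ⟨Na, hNa0, hNa, hNa'⟩ := MemberToZero.exists_bound_lip 𝒞.hΨinvs (𝒞.ρ₁ + 3)
  obtain ⟨Nb, hNb0, hNb, hNb'⟩ :=
    MemberToZero.exists_bound_lip (contDiff_infty_iff_fderiv.mp 𝒞.hΨinvs).2 (𝒞.ρ₁ + 3)
  have hN0 : 0 ≤ Na + Nb := by positivity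
  have hL0 : 0 ≤ 2 * (𝒞.ρ₁ + 3) + 1 := by positivity
  refine ⟨3 * (Na + Nb) * (2 * (𝒞.ρ₁ + 3) + 1) + 2 * (Na + Nb) + 1, by positivity, ?_⟩
  intro θ u hθ hus hC0 hC1 hCr hvan
  have hud : Differentiable ℝ u := hus.differentiable (by simp)
  have hu₀d : Differentiable ℝ u₀ := hu₀s.differentiable (by simp)
  have hd : Differentiable ℝ (fun y => u y - u₀ y) := hud.sub hu₀d
  have hDd : ∀ x, fderiv ℝ (fun y => u y - u₀ y) x = fderiv ℝ u x - fderiv ℝ u₀ x :=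
    fun x => fderiv_fun_sub (hud x) (hu₀d x)
  have key := MemberToZero.dbar_conj_bounds (𝒞.hΨinvs.differentiable (by simp)) hd hN0 hθ hL0
    r.coe_nonneg (fun x hx => (hNa x hx).trans (by linarith))
    (fun x hx x' hx' => (hNa' x hx x' hx').trans (by gcongr; linarith))
    (fun x hx => (hNb x hx).trans (by linarith))
    (fun x hx x' hx' => (hNb' x hx x' hx').trans (by gcongr; linarith)) hC0
    (fun x hx => by rw [hDd]; exact hC1 x hx)
    (fun x hx x' hx' => by rw [hDd, hDd]; exact hCr x hx x' hx')
    (fun x hx x' hx' => MemberToZero.norm_sub_le_mul_rpow (by positivity) r.coe_nonneg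
      (by exact_mod_cast hr1) hx hx')
    (fun x hx => hvan x (by linarith))
  have hp : 0 ≤ 3 * (Na + Nb) * (2 * (𝒞.ρ₁ + 3) + 1) * θ :=
    mul_nonneg (mul_nonneg (mul_nonneg (by norm_num) hN0) hL0) hθ
  have ht : ∀ x x' : ℂ, 0 ≤ θ * ‖x - x'‖ ^ (r : ℝ) := fun x x' => by positivity
  refine ⟨fun x => (key.1 x).trans ?_, fun x x' => (key.2 x x').trans ?_⟩
  · linarith
  · linarith [ht x x']

end Summit.SmoothPoincare4.SmoothPoincare4.Cruxes.TameOrBrodyR4.Sketch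

end
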